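import Mathlib.Geometry.Manifold.Riemannian.Basic
import Literature.Geometry.Lorentzian.InitialData
import Literature.Geometry.Lorentzian.ModelData
import Literature.Geometry.Riemannian.RiemannianMetricExists
import HarnessLib

/-!
# The carrier `InitialDataSet I X` is inhabited (carrier witness, libB)

Topic `Geometry/Lorentzian`. The structure `Literature.Geometry.Lorentzian.InitialDataSet I X`
(`InitialData.lean`: a `C^∞` Riemannian metric `h` on `TX` in Mathlib's bundled form
`Bundle.ContMDiffRiemannianMetric I ∞ E (TangentSpace I : X → Type _)` together with a `C^∞`
symmetric `2`-tensor `k`; Choquet-Bruhat 2009, Ch. VI; Bartnik–Isenberg 2004, §2) is the carrier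
over which the initial-data items of the summit `FinalStateConjecture` quantify, in the shapes
`∀ (X : Type) [TopologicalSpace X] [ChartedSpace E3 X] [IsManifold (𝓡 3) ∞ X] [T2Space X]
[SecondCountableTopology X] …, ∀ D : InitialDataSet (𝓡 3) X, …` and
`∀ D : InitialDataSet 𝓘(ℝ, E3) (Kerr.slice a r₀), …`. This file records, with proofs and no new
notion or named fact, that the carrier is inhabited over that whole region, and exhibits the
standard explicit inhabitants (the time-symmetric Cauchy data of Minkowski space).

## Results

* `InitialDataSet.ofRiemannianMetric h` — **time-symmetric data `(h, 0)`**: every `C^∞`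
  Riemannian metric `h` on `TX` is the metric of an initial data set with `k = 0`
  (Bartnik–Isenberg 2004, §2, time-symmetric data; the zero section of the bundle of bilinear
  forms is smooth, Mathlib's `Bundle.contMDiff_zeroSection`); hence the exact criterion
  `InitialDataSet_nonempty_iff`: **`InitialDataSet I X` is nonempty iff `TX` carries a `C^∞`
  Riemannian metric in Mathlib's sense** (the constraint equations are not fields of the
  structure), for every model `I` and every manifold `X`, with no further hypothesis.
* `InitialDataSet_nonempty` — **the item region**: for every model with corners
  `I : ModelWithCorners ℝ E H` over a finite-dimensional `E` and every `C^∞` manifold `X` on `I`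
  that is Hausdorff and σ-compact, `Nonempty (InitialDataSet I X)`; the metric is the tree's
  PROVED existence theorem for Riemannian metrics
  `Literature.Geometry.Riemannian.nonempty_contMDiffRiemannianMetric` (`RiemannianMetricExists.lean`;
  Lee 2012, Prop. 13.3, partition of unity; Hawking–Ellis 1973, §2.6). Registered as an instance;
  the literal item binders `[T2Space X] [SecondCountableTopology X]`
  (`InitialDataSet_nonempty_of_secondCountable`, instance; `InitialDataSet_nonempty_euclidean` for
  `ChartedSpace E3 X`, `𝓡 3`, the shape of the `FinalStateConjecture` items), and the compact case
  (`InitialDataSet_nonempty_of_compactSpace`). In the finite-dimensional region the criterion reads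
  `Nonempty (InitialDataSet I X) ↔ ∃ g : PseudoRiemannianMetric I ∞ E (TangentSpace I), g.IsRiemannian`
  (`InitialDataSet_nonempty_iff_exists_isRiemannian`).
* Explicit inhabitants (no dimension or countability hypothesis): the **flat time-symmetric data
  `(δ, 0)` of a real inner product space `F`** on `T F` (`InitialDataSet.euclidean F`,
  `InitialDataSet_nonempty_vectorSpace`, instance; Mathlib's `riemannianMetricVectorSpace F`; for
  `F = E3` these are the Cauchy data induced by Minkowski space on `{t = 0}`, Hawking–Ellis 1973,
  §5.1, Christodoulou–Klainerman 1993, §1) — in particular `InitialDataSet (𝓡 3) E3`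
  (`InitialDataSet_nonempty_euclideanSpace_self`, `𝓡 3 = 𝓘(ℝ, E3)` by `rfl`); the **flat data on an
  open subset `U` of `F`** (`InitialDataSet.euclideanOn U`, `InitialDataSet_nonempty_opens`,
  instance) — in particular on the Kerr–Schild slices `Kerr.slice a r₀ : Opens E3`
  (`InitialDataSet_nonempty_kerrSlice`, the carrier of the Kerr-stability items) and on the
  Minkowski slice, where the tree's `trivialData` (`ModelData.lean`) is recovered
  (`InitialDataSet_nonempty_minkowskiSlice`, `euclideanOn_minkowskiSlice_eq_trivialData`).

## Scope

The unrestricted statement `∀ I X, Nonempty (InitialDataSet I X)` is not a theorem and is not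
claimed: by `InitialDataSet_nonempty_iff` it says that every `C^∞` manifold carries a `C^∞`
Riemannian metric, which fails for connected Hausdorff manifolds that are not paracompact (a
Riemannian metric on a connected Hausdorff manifold induces a distance defining the manifold
topology, so the manifold is metrizable, hence paracompact; the long line is a connected Hausdorff
`C^∞` curve which is not paracompact — Lee 2012, Prop. 13.3 and Hawking–Ellis 1973, §2.6 assume
paracompactness, here `[T2Space X] [SigmaCompactSpace X]`), and for a model space `E` of infinite
dimension whose norm is not equivalent to a Hilbert norm (Mathlib's `isVonNBounded` field makes the
metric a *strong* Riemannian metric). Neither region is charted in Mathlib and no `IsEmpty` theorem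
is asserted; every carrier instance in the summit files lies in the region covered here (Hausdorff
second-countable `C^∞` `3`-manifolds on `𝓡 3`, and open subsets of `E3` on `𝓘(ℝ, E3)`).

## References

* Y. Choquet-Bruhat, *General Relativity and the Einstein Equations*, OUP 2009, Ch. VI–VII.
  [ChoquetBruhat2009]
* R. Bartnik, J. Isenberg, *The constraint equations*, in: The Einstein equations and the large
  scale behavior of gravitational fields, Birkhäuser 2004, §2 (time-symmetric data).
  [BartnikIsenberg2004]
* J. M. Lee, *Introduction to Smooth Manifolds*, 2nd ed., GTM 218 (2012), Prop. 13.3. [Lee2012]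
* S. W. Hawking, G. F. R. Ellis, *The large scale structure of space-time*, CUP 1973, §2.6 and
  §5.1. [HawkingEllis1973]
* D. Christodoulou, S. Klainerman, *The global nonlinear stability of the Minkowski space*,
  Princeton 1993, §1 (trivial data). [ChristodoulouKlainerman1993]
* B. O'Neill, *Semi-Riemannian geometry with applications to relativity*, Academic Press 1983,
  Ch. 3, p. 55 and p. 57. [ONeill1983]
-/

noncomputable section

open Manifold Bundle TopologicalSpace
open scoped ContDiff Topology

namespace Literature.Geometry.Lorentzian

/-! ### Time-symmetric data from a Riemannian metric: the exact criterion -/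

section General

variable {E : Type*} [NormedAddCommGroup E] [NormedSpace ℝ E] {H : Type*} [TopologicalSpace H]
  {I : ModelWithCorners ℝ E H} {X : Type*} [TopologicalSpace X] [ChartedSpace H X]
  [IsManifold I ∞ X]

/-- The zero section `x ↦ 0` of the bundle of bilinear forms on `TX` is smooth, for every model
`I` and manifold `X` (Mathlib's `Bundle.contMDiff_zeroSection`; the case `I = 𝓘(ℝ, E3)` is
`contMDiff_zero_bilinSection` of `ModelData.lean`): the smoothness of the tensor `k = 0` of
time-symmetric data. Bartnik–Isenberg 2004, §2. [cite: BartnikIsenberg2004, §2] -/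
theorem InitialDataSet.contMDiff_zero_k :
    ContMDiff I (I.prod 𝓘(ℝ, E →L[ℝ] E →L[ℝ] ℝ)) ∞
      (fun x : X ↦ TotalSpace.mk' (E →L[ℝ] E →L[ℝ] ℝ)
        (E := fun y : X ↦ TangentSpace I y →L[ℝ] TangentSpace I y →L[ℝ] ℝ) x 0) :=
  Bundle.contMDiff_zeroSection ℝ
    (fun y : X ↦ TangentSpace I y →L[ℝ] TangentSpace I y →L[ℝ] ℝ)

/-- **Time-symmetric data `(h, 0)`.** Every `C^∞` Riemannian metric `h` on `TX` is the metric of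
an initial data set, with second fundamental form `k = 0` (a totally geodesic slice; the
constraint equations are not part of the structure `InitialDataSet`). Bartnik–Isenberg 2004, §2
(time-symmetric data); Choquet-Bruhat 2009, Ch. VII. [cite: BartnikIsenberg2004, §2] -/
def InitialDataSet.ofRiemannianMetric
    (h : ContMDiffRiemannianMetric I ∞ E (TangentSpace I : X → Type _)) : InitialDataSet I X where
  h := h
  k _ := 0
  k_symm _ _ _ := rfl
  contMDiff_k := InitialDataSet.contMDiff_zero_k

/-- The metric of the data `(h, 0)` is `h`. [folklore] -/
@[simp]
theorem InitialDataSet.ofRiemannianMetric_h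
    (h : ContMDiffRiemannianMetric I ∞ E (TangentSpace I : X → Type _)) :
    (InitialDataSet.ofRiemannianMetric h).h = h := rfl

/-- The tensor `k` of the data `(h, 0)` vanishes. [folklore] -/
@[simp]
theorem InitialDataSet.ofRiemannianMetric_k
    (h : ContMDiffRiemannianMetric I ∞ E (TangentSpace I : X → Type _)) (x : X) :
    (InitialDataSet.ofRiemannianMetric h).k x = 0 := rfl

/-- The data `(h, 0)` are time-symmetric. Bartnik–Isenberg 2004, §2. [cite: BartnikIsenberg2004, §2] -/
theorem InitialDataSet.ofRiemannianMetric_isTimeSymmetric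
    (h : ContMDiffRiemannianMetric I ∞ E (TangentSpace I : X → Type _)) :
    (InitialDataSet.ofRiemannianMetric h).IsTimeSymmetric := fun _ ↦ rfl

/-- **The exact criterion** (every model `I`, every manifold `X`, no further hypothesis):
`InitialDataSet I X` is inhabited iff the tangent bundle of `X` carries a `C^∞` Riemannian metric
in Mathlib's sense — forwards the field `h`, backwards the time-symmetric data `(h, 0)`.
Bartnik–Isenberg 2004, §2. [cite: BartnikIsenberg2004, §2] -/
theorem InitialDataSet_nonempty_iff :
    Nonempty (InitialDataSet I X) ↔
      Nonempty (ContMDiffRiemannianMetric I ∞ E (TangentSpace I : X → Type _)) :=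
  ⟨fun ⟨D⟩ ↦ ⟨D.h⟩, fun ⟨h⟩ ↦ ⟨InitialDataSet.ofRiemannianMetric h⟩⟩

/-- One direction of the criterion as a map on `Nonempty`. [cite: BartnikIsenberg2004, §2] -/
theorem InitialDataSet_nonempty_of_contMDiffRiemannianMetric
    (h : Nonempty (ContMDiffRiemannianMetric I ∞ E (TangentSpace I : X → Type _))) :
    Nonempty (InitialDataSet I X) :=
  h.map InitialDataSet.ofRiemannianMetric

end General

/-! ### The item region: σ-compact Hausdorff manifolds over a finite-dimensional model -/

section FiniteDimensional

variable {E : Type*} [NormedAddCommGroup E] [NormedSpace ℝ E] [FiniteDimensional ℝ E]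
  {H : Type*} [TopologicalSpace H] {I : ModelWithCorners ℝ E H}
  {X : Type*} [TopologicalSpace X] [ChartedSpace H X] [IsManifold I ∞ X]

/-- In the finite-dimensional region the criterion reads: `InitialDataSet I X` is inhabited iff
`TX` carries a `C^∞` pseudo-Riemannian metric of the tree which is Riemannian (positive
definite) — the two bundled forms of a Riemannian metric correspond under
`PseudoRiemannianMetric.toContMDiffRiemannianMetric` / `ofRiemannian` (boundedness of the unit
balls is automatic in finite dimension, `PseudoRiemannianMetric.isVonNBounded_setOf_lt_one`).
Bartnik–Isenberg 2004, §2; O'Neill 1983, Ch. 3, p. 55. [cite: BartnikIsenberg2004, §2] -/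
theorem InitialDataSet_nonempty_iff_exists_isRiemannian :
    Nonempty (InitialDataSet I X) ↔
      ∃ g : PseudoRiemannianMetric I ∞ E (TangentSpace I : X → Type _), g.IsRiemannian := by
  rw [InitialDataSet_nonempty_iff]
  constructor
  · rintro ⟨h⟩
    exact ⟨PseudoRiemannianMetric.ofRiemannian h,
      PseudoRiemannianMetric.isRiemannian_ofRiemannian h⟩
  · rintro ⟨g, hg⟩
    exact ⟨g.toContMDiffRiemannianMetric hg⟩

/-- **The carrier is inhabited over the item region** (libB carrier witness for
`Literature.Geometry.Lorentzian.InitialDataSet`): for every model with corners `I` over a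
finite-dimensional real normed space `E` and every `C^∞` manifold `X` on `I` that is Hausdorff and
σ-compact (e.g. compact, or second countable — `InitialDataSet_nonempty_of_secondCountable`), the
type `InitialDataSet I X` is nonempty. The inhabitant is the time-symmetric data `(h, 0)` of a
Riemannian metric `h` produced by the partition-of-unity construction
(`Literature.Geometry.Riemannian.nonempty_contMDiffRiemannianMetric`; Lee 2012, Prop. 13.3:
"Every smooth manifold with or without boundary admits a Riemannian metric"; Hawking–Ellis 1973,
§2.6). [cite: Lee2012, Prop. 13.3] [cite: BartnikIsenberg2004, §2] -/
theorem InitialDataSet_nonempty [T2Space X] [SigmaCompactSpace X] : Nonempty (InitialDataSet I X) :=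
  InitialDataSet_nonempty_of_contMDiffRiemannianMetric
    (Literature.Geometry.Riemannian.nonempty_contMDiffRiemannianMetric (I := I) (M := X))

/-- Instance form of `InitialDataSet_nonempty`. [cite: Lee2012, Prop. 13.3] -/
instance instNonemptyInitialDataSet [T2Space X] [SigmaCompactSpace X] :
    Nonempty (InitialDataSet I X) :=
  InitialDataSet_nonempty

/-- **The carrier is inhabited under the literal item binders** `[T2Space X]
[SecondCountableTopology X] [IsManifold I ∞ X]`: a second-countable manifold over a
finite-dimensional real model is locally compact (`Manifold.locallyCompact_of_finiteDimensional`)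
hence σ-compact (`sigmaCompactSpace_of_locallyCompact_secondCountable`), and
`InitialDataSet_nonempty` applies. [cite: Lee2012, Prop. 13.3] -/
theorem InitialDataSet_nonempty_of_secondCountable [T2Space X] [SecondCountableTopology X] :
    Nonempty (InitialDataSet I X) := by
  haveI := Manifold.locallyCompact_of_finiteDimensional (M := X) I
  exact InitialDataSet_nonempty

/-- Instance form of `InitialDataSet_nonempty_of_secondCountable`. [cite: Lee2012, Prop. 13.3] -/
instance instNonemptyInitialDataSetOfSecondCountable [T2Space X] [SecondCountableTopology X] :
    Nonempty (InitialDataSet I X) :=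
  InitialDataSet_nonempty_of_secondCountable

/-- The compact case (closed slices, `[CompactSpace X] [T2Space X]`, no countability hypothesis):
compact spaces are σ-compact. [cite: Lee2012, Prop. 13.3] -/
theorem InitialDataSet_nonempty_of_compactSpace [T2Space X] [CompactSpace X] :
    Nonempty (InitialDataSet I X) :=
  InitialDataSet_nonempty

end FiniteDimensional

/-- **The item shape of the `FinalStateConjecture` summit**: every Hausdorff second-countable
`C^∞` `3`-manifold `X` charted on `E3 = ℝ³` (model `𝓡 3`) carries an initial data set,
`Nonempty (InitialDataSet (𝓡 3) X)` — the carrier of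
`∀ (X : Type) [TopologicalSpace X] [ChartedSpace E3 X] [IsManifold (𝓡 3) ∞ X] [T2Space X]
[SecondCountableTopology X] [ConnectedSpace X], ∀ D : InitialDataSet (𝓡 3) X, …`
(connectedness is not needed). [cite: Lee2012, Prop. 13.3] [cite: BartnikIsenberg2004, §2] -/
theorem InitialDataSet_nonempty_euclidean (X : Type*) [TopologicalSpace X] [ChartedSpace E3 X]
    [IsManifold (𝓡 3) ∞ X] [T2Space X] [SecondCountableTopology X] :
    Nonempty (InitialDataSet (𝓡 3) X) :=
  InitialDataSet_nonempty_of_secondCountable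

/-- The same in every dimension `d`, model `𝓡 d` on `EuclideanSpace ℝ (Fin d)`.
[cite: Lee2012, Prop. 13.3] -/
theorem InitialDataSet_nonempty_euclidean' (d : ℕ) (X : Type*) [TopologicalSpace X]
    [ChartedSpace (EuclideanSpace ℝ (Fin d)) X] [IsManifold (𝓡 d) ∞ X] [T2Space X]
    [SecondCountableTopology X] : Nonempty (InitialDataSet (𝓡 d) X) :=
  InitialDataSet_nonempty_of_secondCountable

/-! ### Explicit inhabitants: flat time-symmetric data on inner product spaces and their opens -/

section ModelSpace

variable (F : Type*) [NormedAddCommGroup F] [InnerProductSpace ℝ F]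

/-- The Euclidean metric `δ = ⟪·, ·⟫` of a real inner product space `F` as a `C^∞` Riemannian
metric on `T F` (Mathlib's analytic `riemannianMetricVectorSpace F`, regularity lowered to `∞`;
same scalar products). O'Neill 1983, Ch. 3, p. 55 (`ℝⁿ_ν`, `ν = 0`). [cite: ONeill1983, Ch. 3 p. 55] -/
def euclideanRiemannianMetric :
    ContMDiffRiemannianMetric 𝓘(ℝ, F) ∞ F (TangentSpace 𝓘(ℝ, F) : F → Type _) where
  inner := (riemannianMetricVectorSpace F).inner
  symm := (riemannianMetricVectorSpace F).symm
  pos := (riemannianMetricVectorSpace F).pos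
  isVonNBounded := (riemannianMetricVectorSpace F).isVonNBounded
  contMDiff := (riemannianMetricVectorSpace F).contMDiff.of_le le_top

/-- The Euclidean metric at `x` is `δ = innerSL ℝ`. [cite: ONeill1983, Ch. 3 p. 55] -/
@[simp]
theorem euclideanRiemannianMetric_inner (x : F) :
    (euclideanRiemannianMetric F).inner x = (innerSL ℝ (E := F) : F →L[ℝ] F →L[ℝ] ℝ) := rfl

/-- **The flat time-symmetric data `(δ, 0)` on a real inner product space `F`** (slice `F`,
metric the inner product on every tangent space, `k = 0`); for `F = E3` the Cauchy data induced
by Minkowski space on `{t = 0}`. Hawking–Ellis 1973, §5.1; Christodoulou–Klainerman 1993, §1;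
O'Neill 1983, Ch. 3, p. 55. [cite: HawkingEllis1973, §5.1] -/
def InitialDataSet.euclidean : InitialDataSet 𝓘(ℝ, F) F :=
  InitialDataSet.ofRiemannianMetric (euclideanRiemannianMetric F)

/-- The metric of the flat data is `δ`. [cite: ONeill1983, Ch. 3 p. 55] -/
@[simp]
theorem InitialDataSet.euclidean_h_inner (x : F) :
    (InitialDataSet.euclidean F).h.inner x = (innerSL ℝ (E := F) : F →L[ℝ] F →L[ℝ] ℝ) := rfl

/-- The tensor `k` of the flat data vanishes. [cite: ChristodoulouKlainerman1993, §1] -/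
@[simp]
theorem InitialDataSet.euclidean_k (x : F) : (InitialDataSet.euclidean F).k x = 0 := rfl

/-- The flat data are time-symmetric. [cite: BartnikIsenberg2004, §2] -/
theorem InitialDataSet.euclidean_isTimeSymmetric : (InitialDataSet.euclidean F).IsTimeSymmetric :=
  fun _ ↦ rfl

/-- **The carrier is inhabited on every real inner product space** regarded as a manifold
modelled on itself (no dimension or countability hypothesis): the flat data `(δ, 0)`.
[cite: HawkingEllis1973, §5.1] [cite: ONeill1983, Ch. 3 p. 55] -/
theorem InitialDataSet_nonempty_vectorSpace : Nonempty (InitialDataSet 𝓘(ℝ, F) F) :=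
  ⟨InitialDataSet.euclidean F⟩

/-- Instance form of `InitialDataSet_nonempty_vectorSpace`. [cite: ONeill1983, Ch. 3 p. 55] -/
instance instNonemptyInitialDataSetVectorSpace : Nonempty (InitialDataSet 𝓘(ℝ, F) F) :=
  InitialDataSet_nonempty_vectorSpace F

/-- The carrier at the model space of the items, `X = E3` with `𝓡 3 = 𝓘(ℝ, E3)` (`rfl`): the
trivial (Minkowski) data `(ℝ³, δ, 0)`. [cite: HawkingEllis1973, §5.1] -/
theorem InitialDataSet_nonempty_euclideanSpace_self : Nonempty (InitialDataSet (𝓡 3) E3) :=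
  InitialDataSet_nonempty_vectorSpace E3

variable {F}

/-- The unit ball `{v | ⟪v, v⟫ < 1}` of the Euclidean form on `T_y U = F`, `U` an open subset of
`F`, is von Neumann bounded (transport of the field of Mathlib's `riemannianMetricVectorSpace F`
along the definitional equality of the fibres; the pattern of `Minkowski.isVonNBounded_inner_slice`).
O'Neill 1983, Ch. 3, p. 55. [cite: ONeill1983, Ch. 3 p. 55] -/
theorem isVonNBounded_inner_opens (U : Opens F) (y : U) :
    Bornology.IsVonNBounded ℝ
      {v : TangentSpace 𝓘(ℝ, F) y | (innerSL ℝ (E := F) : F →L[ℝ] F →L[ℝ] ℝ) v v < 1} :=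
  (riemannianMetricVectorSpace F).isVonNBounded y.1

variable (F) in
/-- The Euclidean metric `δ` restricted to an open subset `U ⊆ F` as a `C^∞` Riemannian metric on
`T U` (`T_y U = F`; the constant section `δ` is smooth by `OpensSection.contMDiff_bilinSection`,
the preferred trivializations of `T U` being the identity). O'Neill 1983, Ch. 3, p. 55 and p. 57
(open submanifolds). [cite: ONeill1983, Ch. 3 p. 57] -/
def euclideanRiemannianMetricOn (U : Opens F) :
    ContMDiffRiemannianMetric 𝓘(ℝ, F) ∞ F (TangentSpace 𝓘(ℝ, F) : U → Type _) where
  inner _ := (innerSL ℝ (E := F) : F →L[ℝ] F →L[ℝ] ℝ)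
  symm _ v w := real_inner_comm (F := F) w v
  pos _ _ hv := (real_inner_self_pos (F := F)).2 hv
  isVonNBounded := isVonNBounded_inner_opens U
  contMDiff := OpensSection.contMDiff_bilinSection U _ contMDiff_const

/-- The restricted Euclidean metric at `y : U` is `δ`. [cite: ONeill1983, Ch. 3 p. 57] -/
@[simp]
theorem euclideanRiemannianMetricOn_inner (U : Opens F) (y : U) :
    (euclideanRiemannianMetricOn F U).inner y = (innerSL ℝ (E := F) : F →L[ℝ] F →L[ℝ] ℝ) := rfl

variable (F) in
/-- **The flat time-symmetric data `(δ, 0)` on an open subset `U` of a real inner product space**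
(the data induced by Minkowski space `ℝ × F` on the open piece `{0} × U` of the slice `{t = 0}`).
Hawking–Ellis 1973, §5.1; O'Neill 1983, Ch. 3, p. 55 and p. 57. [cite: HawkingEllis1973, §5.1] -/
def InitialDataSet.euclideanOn (U : Opens F) : InitialDataSet 𝓘(ℝ, F) U :=
  InitialDataSet.ofRiemannianMetric (euclideanRiemannianMetricOn F U)

/-- The metric of the flat data on `U` is `δ`. [cite: ONeill1983, Ch. 3 p. 57] -/
@[simp]
theorem InitialDataSet.euclideanOn_h_inner (U : Opens F) (y : U) :
    (InitialDataSet.euclideanOn F U).h.inner y = (innerSL ℝ (E := F) : F →L[ℝ] F →L[ℝ] ℝ) := rfl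

/-- The tensor `k` of the flat data on `U` vanishes. [cite: ChristodoulouKlainerman1993, §1] -/
@[simp]
theorem InitialDataSet.euclideanOn_k (U : Opens F) (y : U) :
    (InitialDataSet.euclideanOn F U).k y = 0 := rfl

/-- The flat data on `U` are time-symmetric. [cite: BartnikIsenberg2004, §2] -/
theorem InitialDataSet.euclideanOn_isTimeSymmetric (U : Opens F) :
    (InitialDataSet.euclideanOn F U).IsTimeSymmetric := fun _ ↦ rfl

/-- **The carrier is inhabited on every open subset of a real inner product space** (model
`𝓘(ℝ, F)`, no dimension hypothesis): the flat data `(δ, 0)`. [cite: HawkingEllis1973, §5.1] -/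
theorem InitialDataSet_nonempty_opens (U : Opens F) : Nonempty (InitialDataSet 𝓘(ℝ, F) U) :=
  ⟨InitialDataSet.euclideanOn F U⟩

/-- Instance form of `InitialDataSet_nonempty_opens`. [cite: HawkingEllis1973, §5.1] -/
instance instNonemptyInitialDataSetOpens (U : Opens F) : Nonempty (InitialDataSet 𝓘(ℝ, F) U) :=
  InitialDataSet_nonempty_opens U

/-- **The carrier of the Kerr-stability items**, `InitialDataSet 𝓘(ℝ, E3) (Kerr.slice a r₀)` on
the Kerr–Schild slice `Kerr.slice a r₀ : Opens E3` (`KerrData.lean`), is inhabited for all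
parameters `a`, `r₀` — by the flat data `(δ, 0)` on that open set (a witness of inhabitation, not
the Kerr data `Kerr.data`, which take the instance hypotheses `[Kerr.Facts] [Kerr.SliceFacts]`).
[cite: HawkingEllis1973, §5.1] -/
theorem InitialDataSet_nonempty_kerrSlice (a r₀ : ℝ) :
    Nonempty (InitialDataSet 𝓘(ℝ, E3) (Kerr.slice a r₀)) :=
  InitialDataSet_nonempty_opens (Kerr.slice a r₀)

/-- On the Minkowski slice `Minkowski.slice = ⊤ ⊆ E3` the flat data of this file are the tree's
trivial data `trivialData = (ℝ³, δ, 0)` of `ModelData.lean` (same fields). Hawking–Ellis 1973,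
§5.1; Christodoulou–Klainerman 1993, §1. [cite: HawkingEllis1973, §5.1] -/
theorem euclideanOn_minkowskiSlice_eq_trivialData :
    InitialDataSet.euclideanOn E3 Minkowski.slice = trivialData := rfl

/-- The carrier `InitialDataSet 𝓘(ℝ, E3) Minkowski.slice` of the Minkowski-stability items is
inhabited by the trivial data. [cite: HawkingEllis1973, §5.1] -/
theorem InitialDataSet_nonempty_minkowskiSlice :
    Nonempty (InitialDataSet 𝓘(ℝ, E3) Minkowski.slice) :=
  ⟨trivialData⟩

end ModelSpace

end Literature.Geometry.Lorentzian

end
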